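import Literature.NumberTheory.EllipticCurves.SingularCubicMapProofs
import Literature.NumberTheory.EllipticCurves.VariableChangePoints
import Mathlib.AlgebraicGeometry.EllipticCurve.Reduction
import Mathlib.Algebra.Polynomial.Splits
import Mathlib.FieldTheory.Galois.Infinite
import Mathlib.FieldTheory.IsAlgClosed.AlgebraicClosure
import Mathlib.FieldTheory.Finite.Basic
import HarnessLib

/-!
# The number of nonsingular points of a singular Weierstrass cubic over a finite field

Proof file (theorems only).  For a Weierstrass cubic `V` over a finite field `k` with `q`
elements and `Δ = 0`, Mathlib's `V.toAffine.Point` is Silverman's `E_ns(k)` (the point at infinity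
and the nonsingular affine points), and

* `WeierstrassCurve.natCard_point_of_Δ_eq_zero`: `#E_ns(k) = q - 1` at a split node (`c₄ ≠ 0`
  and Mathlib's splitting quadratic `c₄T² + a₁c₄T - (54b₆ - 3b₂b₄ + a₂c₄)` of
  `WeierstrassCurve.HasSplitMultiplicativeReduction` splits over `k`), `q + 1` at a non-split
  node (`c₄ ≠ 0`, the quadratic does not split), `q` at a cusp (`c₄ = 0`)

(Silverman, *AEC*, Prop. III.2.5 with Exercise 3.5: `E_ns ≅ 𝔾_m`, a non-split torus, `𝔾_a`).
The proof is the elementary count: a singular Weierstrass cubic over a perfect field has a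
*rational* singular point (`WeierstrassCurve.exists_singularPoint_of_perfectField`: over `k̄`
there is one, `exists_singularPoint`, unique, `singularModel.apply_eq_of_map_eq`, hence Galois
fixed); translating it to the origin gives `a₃ = a₄ = a₆ = 0` (`translate_a₃₄₆`), where the
nonsingular points are `(Q(t), tQ(t))`, `Q(t) = t² + a₁t - a₂ ≠ 0`, `t = y/x`
(`WeierstrassCurve.nonempty_nonsingularEquivParam`), so that
`#E_ns(k) + #{t ∈ k : Q(t) = 0} = q + 1` (`WeierstrassCurve.natCard_point_add_card_roots_of_a₃₄₆`);
finally `c₄ = disc(Q)²` and the splitting quadratic is `c₄ · Q` (translation invariant,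
`WeierstrassCurve.translate_splittingConstant`), and a monic quadratic over a finite field has
`2`, `0` or `1` roots in the three cases (`WeierstrassCurve.card_filter_quadratic_eq`).
This serves the comparison of the local BSD factors of isogenous curves
(`IsogenyReductionPointCountProofs`: equal local `L`-factors force equal `#Ẽ_ns(𝔽_p)`).

## References

* [SilvermanAEC2009] J. H. Silverman, *The Arithmetic of Elliptic Curves*, 2nd ed. (2009),
  Prop. III.1.4(a), Prop. III.2.5, Exercise 3.5 (PDF pp. 59, 97), VII.§5.
-/

noncomputable section

open Polynomial

namespace WeierstrassCurve

universe u

variable {k : Type u} [Field k]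

/-! ## Translating a rational singular point to the origin -/

section Translate

variable (V : WeierstrassCurve k) {x₀ y₀ : k}

/-- Translations do not change `a₁`. [folklore] -/
theorem translate_a₁ : ((⟨1, x₀, 0, y₀⟩ : VariableChange k) • V).a₁ = V.a₁ := by
  simp [variableChange_a₁]

/-- A translation by `x₀` changes `a₂` to `a₂ + 3x₀`. [folklore] -/
theorem translate_a₂ : ((⟨1, x₀, 0, y₀⟩ : VariableChange k) • V).a₂ = V.a₂ + 3 * x₀ := by
  simp [variableChange_a₂]

/-- At a singular point `(x₀, y₀)` (`f = f_x = f_y = 0`) the translated equation has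
`a₃ = a₄ = a₆ = 0` (Silverman, *AEC*, proof of Prop. III.1.4(a)). [folklore] -/
theorem translate_a₃ (hY : 2 * y₀ + V.a₁ * x₀ + V.a₃ = 0) : ((⟨1, x₀, 0, y₀⟩ : VariableChange k) • V).a₃ = 0 := by
  simp only [variableChange_a₃, inv_one, Units.val_one, one_pow, one_mul]
  linear_combination hY

/-- At a singular point the translated equation has `a₄ = 0` (`f_x = 0`). [folklore] -/
theorem translate_a₄ (hX : V.a₁ * y₀ = 3 * x₀ ^ 2 + 2 * V.a₂ * x₀ + V.a₄) :
    ((⟨1, x₀, 0, y₀⟩ : VariableChange k) • V).a₄ = 0 := by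
  simp only [variableChange_a₄, inv_one, Units.val_one, one_pow, one_mul]
  linear_combination -hX

/-- At a point of the curve the translated equation has `a₆ = 0` (`f = 0`). [folklore] -/
theorem translate_a₆ (hE : V.toAffine.Equation x₀ y₀) : ((⟨1, x₀, 0, y₀⟩ : VariableChange k) • V).a₆ = 0 := by
  rw [Affine.equation_iff] at hE
  simp only [variableChange_a₆, inv_one, Units.val_one, one_pow, one_mul]
  linear_combination -hE

/-- Translations do not change `c₄`. [folklore] -/
theorem translate_c₄ : ((⟨1, x₀, 0, y₀⟩ : VariableChange k) • V).c₄ = V.c₄ := by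
  simp [variableChange_c₄]

/-- The expression `54 b₆ - 3 b₂ b₄ + a₂ c₄` of Mathlib's `HasSplitMultiplicativeReduction` is
invariant under translations (a polynomial identity). [folklore] -/
theorem translate_splittingConstant :
    54 * ((⟨1, x₀, 0, y₀⟩ : VariableChange k) • V).b₆ - 3 * ((⟨1, x₀, 0, y₀⟩ : VariableChange k) • V).b₂ * ((⟨1, x₀, 0, y₀⟩ : VariableChange k) • V).b₄ +
        ((⟨1, x₀, 0, y₀⟩ : VariableChange k) • V).a₂ * ((⟨1, x₀, 0, y₀⟩ : VariableChange k) • V).c₄ =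
      54 * V.b₆ - 3 * V.b₂ * V.b₄ + V.a₂ * V.c₄ := by
  simp only [variableChange_b₂, variableChange_b₄, variableChange_b₆,
    variableChange_a₂, variableChange_c₄, inv_one, Units.val_one, one_pow, one_mul]
  simp only [b₂, b₄, b₆, c₄]
  ring

end Translate

/-! ## Curves with `a₃ = a₄ = a₆ = 0`: the nonsingular points -/

section Origin

variable (V : WeierstrassCurve k) (h₃ : V.a₃ = 0) (h₄ : V.a₄ = 0) (h₆ : V.a₆ = 0)
include h₃ h₄ h₆

/-- The equation `y² + a₁xy = x³ + a₂x²` when `a₃ = a₄ = a₆ = 0`. [folklore] -/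
theorem equation_iff_of_a₃₄₆ (x y : k) :
    V.toAffine.Equation x y ↔ y ^ 2 + V.a₁ * x * y = x ^ 3 + V.a₂ * x ^ 2 := by
  rw [Affine.equation_iff, h₃, h₄, h₆]
  constructor <;> intro h <;> linear_combination h

/-- On `y² + a₁xy = x³ + a₂x²` the singular point is the origin: a solution is nonsingular iff
`x ≠ 0` (`2f - y f_y - x f_x = x³`). Silverman, *AEC*, III.1.4(a). [folklore] -/
theorem nonsingular_iff_of_a₃₄₆ (x y : k) :
    V.toAffine.Nonsingular x y ↔ V.toAffine.Equation x y ∧ x ≠ 0 := by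
  rw [Affine.nonsingular_iff']
  refine and_congr_right fun hE => ?_
  rw [equation_iff_of_a₃₄₆ V h₃ h₄ h₆] at hE
  rw [h₃, h₄]
  constructor
  · rintro h rfl
    have hy : y = 0 := by
      have : y ^ 2 = 0 := by linear_combination hE
      exact pow_eq_zero_iff (n := 2) (by norm_num) |>.mp this
    subst hy
    simp at h
  · intro hx
    by_contra h
    simp only [not_or, not_ne_iff] at h
    obtain ⟨h1, h2⟩ := h
    apply hx
    have h1' : V.a₁ * y - (3 * x ^ 2 + 2 * V.a₂ * x + 0) = 0 := h1
    have h2' : 2 * y + V.a₁ * x + 0 = 0 := h2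
    have : x ^ 3 = 0 := by linear_combination 2 * hE - y * h2' - x * h1'
    exact pow_eq_zero_iff (n := 3) (by norm_num) |>.mp this

/-- The tangent parameter: nonsingular points of `y² + a₁xy = x³ + a₂x²` are
`(Q(t), tQ(t))`, `Q(t) = t² + a₁t - a₂ ≠ 0`, `t = y/x` (the line of slope `t` through the
singular point). Silverman, *AEC*, proof of III.2.5. [folklore] -/
theorem nonempty_nonsingularEquivParam :
    Nonempty ({xy : k × k // V.toAffine.Nonsingular xy.1 xy.2} ≃
      {t : k // t ^ 2 + V.a₁ * t - V.a₂ ≠ 0}) := ⟨{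
  toFun P := ⟨P.1.2 / P.1.1, by
    obtain ⟨⟨x, y⟩, hP⟩ := P
    obtain ⟨hE, hx⟩ := (nonsingular_iff_of_a₃₄₆ V h₃ h₄ h₆ x y).mp hP
    rw [equation_iff_of_a₃₄₆ V h₃ h₄ h₆] at hE
    dsimp only
    have : (y / x) ^ 2 + V.a₁ * (y / x) - V.a₂ = x := by
      field_simp
      linear_combination hE
    rw [this]
    exact hx⟩
  invFun t := ⟨(t.1 ^ 2 + V.a₁ * t.1 - V.a₂, t.1 * (t.1 ^ 2 + V.a₁ * t.1 - V.a₂)), by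
    obtain ⟨t, ht⟩ := t
    rw [nonsingular_iff_of_a₃₄₆ V h₃ h₄ h₆, equation_iff_of_a₃₄₆ V h₃ h₄ h₆]
    exact ⟨by ring, ht⟩⟩
  left_inv P := by
    obtain ⟨⟨x, y⟩, hP⟩ := P
    obtain ⟨hE, hx⟩ := (nonsingular_iff_of_a₃₄₆ V h₃ h₄ h₆ x y).mp hP
    rw [equation_iff_of_a₃₄₆ V h₃ h₄ h₆] at hE
    have hq : (y / x) ^ 2 + V.a₁ * (y / x) - V.a₂ = x := by
      field_simp
      linear_combination hE
    apply Subtype.ext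
    simp only [hq, Prod.mk.injEq, true_and]
    field_simp
  right_inv t := by
    obtain ⟨t, ht⟩ := t
    apply Subtype.ext
    show t * (t ^ 2 + V.a₁ * t - V.a₂) / (t ^ 2 + V.a₁ * t - V.a₂) = t
    exact mul_div_cancel_right₀ t ht }⟩

/-- **Point count, origin-singular form.** Over a finite field with `q` elements,
`#V(k)_ns + #{t ∈ k : t² + a₁t - a₂ = 0} = q + 1` for `V : y² + a₁xy = x³ + a₂x²` (Mathlib's
`V.toAffine.Point` is `E_ns(k)`: `O` and the nonsingular affine points). [folklore] -/
theorem natCard_point_add_card_roots_of_a₃₄₆ [Fintype k] [DecidableEq k] :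
    Nat.card V.toAffine.Point + (Finset.univ.filter fun t : k => t ^ 2 + V.a₁ * t - V.a₂ = 0).card =
      Fintype.card k + 1 := by
  have h1 : Nat.card V.toAffine.Point =
      Nat.card {xy : k × k // V.toAffine.Nonsingular xy.1 xy.2} + 1 := by
    rw [Nat.card_congr V.toAffine.nonsingularPointEquiv]
    exact Finite.card_option
  obtain ⟨e⟩ := nonempty_nonsingularEquivParam V h₃ h₄ h₆
  rw [h1, Nat.card_congr e, Nat.card_eq_fintype_card, Fintype.card_subtype]
  have := Finset.card_filter_add_card_filter_not (s := Finset.univ)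
    (fun t : k => t ^ 2 + V.a₁ * t - V.a₂ ≠ 0)
  simp only [not_not, Finset.card_univ] at this
  omega

end Origin

/-! ## A rational singular point over a perfect field -/

section Perfect

variable (V : WeierstrassCurve k)

/-- **A singular Weierstrass cubic over a perfect field has a rational singular point.** Over
`k̄` there is a singular point (`exists_singularPoint`), unique (`singularModel.apply_eq_of_map_eq`
after `eq_singularModel`), hence fixed by `Aut(k̄/k)` and rational
(`InfiniteGalois.mem_range_algebraMap_iff_fixed`). Silverman, *AEC*, Prop. III.1.4(a) (a singular
Weierstrass cubic has exactly one singular point). [cite: SilvermanAEC2009, Prop. III.1.4(a)] -/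
theorem exists_singularPoint_of_perfectField [PerfectField k] (hΔ : V.Δ = 0) :
    ∃ x₀ y₀ : k, V.toAffine.Equation x₀ y₀ ∧
      V.a₁ * y₀ = 3 * x₀ ^ 2 + 2 * V.a₂ * x₀ + V.a₄ ∧ 2 * y₀ + V.a₁ * x₀ + V.a₃ = 0 := by
  classical
  set kb := AlgebraicClosure k
  haveI : IsGalois k kb := {}
  set Vb := V.map (algebraMap k kb) with hVb
  have hΔb : Vb.Δ = 0 := by rw [hVb, map_Δ, hΔ, map_zero]
  obtain ⟨x, y, hE, hX, hY⟩ := Vb.exists_singularPoint hΔb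
  obtain ⟨α₁, α₂, hs, hp⟩ := Vb.exists_tangentSlopes x
  have hmodel := Vb.eq_singularModel hE hX hY hs hp
  -- every `k`-automorphism fixes `(x, y)`
  have hfix : ∀ τ : kb ≃ₐ[k] kb, τ x = x ∧ τ y = y := by
    intro τ
    have hmap : (singularModel x y α₁ α₂).map (τ : kb →+* kb) = singularModel x y α₁ α₂ := by
      rw [← hmodel, hVb, map_map]
      congr 1
      ext a
      simp
    have h := singularModel.apply_eq_of_map_eq hmap
    exact ⟨h.1, h.2.1⟩
  obtain ⟨x₀, hx₀⟩ := (InfiniteGalois.mem_range_algebraMap_iff_fixed x).mpr fun τ => (hfix τ).1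
  obtain ⟨y₀, hy₀⟩ := (InfiniteGalois.mem_range_algebraMap_iff_fixed y).mpr fun τ => (hfix τ).2
  refine ⟨x₀, y₀, ?_, ?_, ?_⟩
  · rw [← Affine.map_equation V (algebraMap k kb).injective x₀ y₀]
    change Vb.toAffine.Equation (algebraMap k kb x₀) (algebraMap k kb y₀)
    rwa [hx₀, hy₀]
  · apply (algebraMap k kb).injective
    rw [← hx₀, ← hy₀, hVb] at hX
    simp only [map_a₁, map_a₂, map_a₄] at hX
    simpa only [map_mul, map_add, map_pow, map_ofNat] using hX
  · apply (algebraMap k kb).injective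
    rw [← hx₀, ← hy₀, hVb] at hY
    simp only [map_a₁, map_a₃] at hY
    simpa only [map_mul, map_add, map_ofNat, map_zero] using hY

end Perfect

/-! ## The three counts over a finite field -/

section Finite

variable [Finite k] (V : WeierstrassCurve k)

omit [Finite k] in
/-- Mathlib's splitting quadratic `c₄ T² + a₁c₄ T - (54 b₆ - 3 b₂b₄ + a₂c₄)` (of
`HasSplitMultiplicativeReduction`) is invariant under translations. [folklore] -/
theorem splittingQuadratic_translate (x₀ y₀ : k) :
    (C ((⟨1, x₀, 0, y₀⟩ : VariableChange k) • V).c₄ * X ^ 2 +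
        C (((⟨1, x₀, 0, y₀⟩ : VariableChange k) • V).a₁ * ((⟨1, x₀, 0, y₀⟩ : VariableChange k) • V).c₄) * X -
        C (54 * ((⟨1, x₀, 0, y₀⟩ : VariableChange k) • V).b₆ -
          3 * ((⟨1, x₀, 0, y₀⟩ : VariableChange k) • V).b₂ * ((⟨1, x₀, 0, y₀⟩ : VariableChange k) • V).b₄ +
          ((⟨1, x₀, 0, y₀⟩ : VariableChange k) • V).a₂ * ((⟨1, x₀, 0, y₀⟩ : VariableChange k) • V).c₄) : k[X]) =
      C V.c₄ * X ^ 2 + C (V.a₁ * V.c₄) * X - C (54 * V.b₆ - 3 * V.b₂ * V.b₄ + V.a₂ * V.c₄) := by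
  rw [translate_splittingConstant, translate_c₄, translate_a₁]

omit [Finite k] in
/-- In origin-singular form (`a₃ = a₄ = a₆ = 0`) the splitting quadratic is `c₄ · (T² + a₁T - a₂)`
and `c₄ = (a₁² + 4a₂)²` is the square of the discriminant of the tangent quadratic. [folklore] -/
theorem splittingQuadratic_of_a₃₄₆ (h₃ : V.a₃ = 0) (h₄ : V.a₄ = 0) (h₆ : V.a₆ = 0) :
    (C V.c₄ * X ^ 2 + C (V.a₁ * V.c₄) * X - C (54 * V.b₆ - 3 * V.b₂ * V.b₄ + V.a₂ * V.c₄) : k[X]) =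
        C V.c₄ * (X ^ 2 + C V.a₁ * X - C V.a₂) ∧
      V.c₄ = (V.a₁ ^ 2 + 4 * V.a₂) ^ 2 := by
  have hb₄ : V.b₄ = 0 := by rw [b₄, h₃, h₄]; ring
  have hb₆ : V.b₆ = 0 := by rw [b₆, h₃, h₆]; ring
  have hc₄ : V.c₄ = (V.a₁ ^ 2 + 4 * V.a₂) ^ 2 := by rw [c₄, hb₄, b₂]; ring
  refine ⟨?_, hc₄⟩
  rw [hb₄, hb₆]
  simp only [mul_zero, sub_zero, zero_add, C_mul]
  ring

/-- Over a finite field, a monic quadratic `T² + bT + c` with `b² - 4c ≠ 0` (i.e. `c₄ ≠ 0`) and a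
root has exactly two roots; with no root, none; with `b² = 4c`, exactly one (finite fields are
perfect: in characteristic `2`, `b = 0` and `c` is a square). [folklore] -/
theorem card_filter_quadratic_eq [Fintype k] [DecidableEq k] (b c : k) :
    ((b ^ 2 - 4 * c ≠ 0 → (∃ t : k, t ^ 2 + b * t + c = 0) →
        (Finset.univ.filter fun t : k => t ^ 2 + b * t + c = 0).card = 2) ∧
      ((¬ ∃ t : k, t ^ 2 + b * t + c = 0) →
        (Finset.univ.filter fun t : k => t ^ 2 + b * t + c = 0).card = 0) ∧
      (b ^ 2 - 4 * c = 0 → (Finset.univ.filter fun t : k => t ^ 2 + b * t + c = 0).card = 1)) := by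
  refine ⟨fun hdisc ⟨t₁, ht₁⟩ => ?_, fun hno => ?_, fun hdisc => ?_⟩
  · -- two distinct roots `t₁`, `t₂ = -b - t₁`
    set t₂ := -b - t₁ with ht₂
    have hne : t₁ ≠ t₂ := by
      intro h
      apply hdisc
      have e' : b + 2 * t₁ = 0 := by linear_combination h + ht₂
      linear_combination (b + 2 * t₁) * e' - 4 * ht₁
    have hset : (Finset.univ.filter fun t : k => t ^ 2 + b * t + c = 0) = {t₁, t₂} := by
      ext t
      simp only [Finset.mem_filter, Finset.mem_univ, true_and, Finset.mem_insert,
        Finset.mem_singleton]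
      constructor
      · intro ht
        have : (t - t₁) * (t - t₂) = 0 := by rw [ht₂]; linear_combination ht - ht₁
        rcases mul_eq_zero.mp this with h | h
        · exact Or.inl (sub_eq_zero.mp h)
        · exact Or.inr (sub_eq_zero.mp h)
      · rintro (rfl | rfl)
        · exact ht₁
        · rw [ht₂]; linear_combination ht₁
    rw [hset, Finset.card_pair hne]
  · rw [Finset.card_eq_zero, Finset.filter_eq_empty_iff]
    exact fun t _ ht => hno ⟨t, ht⟩
  · -- a double root
    obtain ⟨α, hα⟩ : ∃ α : k, ∀ t : k, t ^ 2 + b * t + c = (t - α) ^ 2 := by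
      by_cases h2 : (2 : k) = 0
      · -- characteristic 2: `b² = 0`, `c = s²`
        have hb : b = 0 := by
          have : b ^ 2 = 0 := by linear_combination hdisc + 2 * c * h2
          exact pow_eq_zero_iff (n := 2) (by norm_num) |>.mp this
        haveI := Fintype.ofFinite k
        have hchar : ringChar k = 2 := by
          have h2' := h2
          rw [show (2 : k) = (2 : ℕ) by norm_cast, ringChar.spec] at h2'
          rcases (Nat.dvd_prime Nat.prime_two).mp h2' with h | h
          · exact absurd h (CharP.ringChar_ne_one)
          · exact h
        obtain ⟨s, hs⟩ := FiniteField.isSquare_of_char_two hchar c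
        refine ⟨s, fun t => ?_⟩
        rw [hb, hs]
        linear_combination t * s * h2
      · refine ⟨-b / 2, fun t => ?_⟩
        field_simp
        linear_combination -hdisc
    have hset : (Finset.univ.filter fun t : k => t ^ 2 + b * t + c = 0) = {α} := by
      ext t
      simp only [Finset.mem_filter, Finset.mem_univ, true_and, Finset.mem_singleton, hα,
        pow_eq_zero_iff (two_ne_zero), sub_eq_zero]
    rw [hset, Finset.card_singleton]

/-- **Point counts of singular Weierstrass cubics over a finite field `k` with `q` elements**
(Silverman, *AEC*, Prop. III.2.5 with Exercise 3.5: `E_ns(k) ≅ k^×`, the norm-one torus of the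
quadratic extension, or `k⁺`): for `V` with `Δ = 0`,
* split node (`c₄ ≠ 0`, Mathlib's splitting quadratic splits): `#V(k)_ns = q - 1`;
* non-split node (`c₄ ≠ 0`, the quadratic does not split): `#V(k)_ns = q + 1`;
* cusp (`c₄ = 0`): `#V(k)_ns = q`.
Proof: translate the rational singular point (`exists_singularPoint_of_perfectField`) to the
origin and count the lines through it (`natCard_point_add_card_roots_of_a₃₄₆`): the tangent
quadratic `T² + a₁T - a₂` has `2`, `0`, `1` roots in `k` respectively.
[cite: SilvermanAEC2009, Prop. III.2.5 and Exercise 3.5 (PDF pp. 59, 97)] -/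
theorem natCard_point_of_Δ_eq_zero [DecidableEq k] (hΔ : V.Δ = 0) :
    (V.c₄ ≠ 0 → (C V.c₄ * X ^ 2 + C (V.a₁ * V.c₄) * X -
        C (54 * V.b₆ - 3 * V.b₂ * V.b₄ + V.a₂ * V.c₄) : k[X]).Splits →
        Nat.card V.toAffine.Point + 1 = Nat.card k) ∧
      (V.c₄ ≠ 0 → ¬ (C V.c₄ * X ^ 2 + C (V.a₁ * V.c₄) * X -
        C (54 * V.b₆ - 3 * V.b₂ * V.b₄ + V.a₂ * V.c₄) : k[X]).Splits →
        Nat.card V.toAffine.Point = Nat.card k + 1) ∧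
      (V.c₄ = 0 → Nat.card V.toAffine.Point = Nat.card k) := by
  haveI := Fintype.ofFinite k
  haveI : PerfectField k := PerfectField.ofFinite
  obtain ⟨x₀, y₀, hE, hX, hY⟩ := V.exists_singularPoint_of_perfectField hΔ
  set V' := (⟨1, x₀, 0, y₀⟩ : VariableChange k) • V with hV'
  have h₃ : V'.a₃ = 0 := V.translate_a₃ hY
  have h₄ : V'.a₄ = 0 := V.translate_a₄ hX
  have h₆ : V'.a₆ = 0 := V.translate_a₆ hE
  have hcard : Nat.card V.toAffine.Point = Nat.card V'.toAffine.Point :=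
    Nat.card_congr (VariableChange.pointEquiv V (⟨1, x₀, 0, y₀⟩ : VariableChange k)).toEquiv
  have hcount := V'.natCard_point_add_card_roots_of_a₃₄₆ h₃ h₄ h₆
  obtain ⟨hQ, hc₄'⟩ := V'.splittingQuadratic_of_a₃₄₆ h₃ h₄ h₆
  have hQV := (V.splittingQuadratic_translate x₀ y₀).symm
  rw [← hV'] at hQV
  have hc₄V : V.c₄ = V'.c₄ := (V.translate_c₄).symm
  obtain ⟨htwo, hzero, hone⟩ := card_filter_quadratic_eq (k := k) V'.a₁ (-V'.a₂)
  have hdisc : V'.a₁ ^ 2 - 4 * -V'.a₂ = V'.a₁ ^ 2 + 4 * V'.a₂ := by ring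
  rw [hdisc] at htwo hone
  have hfilt : (Finset.univ.filter fun t : k => t ^ 2 + V'.a₁ * t + -V'.a₂ = 0) =
      Finset.univ.filter fun t : k => t ^ 2 + V'.a₁ * t - V'.a₂ = 0 := by
    simp only [← sub_eq_add_neg]
  rw [hfilt] at htwo hzero hone
  rw [hcard, hQV, hc₄V, Nat.card_eq_fintype_card (α := k), hQ, hc₄']
  set Q : k[X] := X ^ 2 + C V'.a₁ * X - C V'.a₂ with hQdef
  have heval : ∀ t : k, Q.eval t = t ^ 2 + V'.a₁ * t + -V'.a₂ := fun t => by
    simp only [hQdef, eval_sub, eval_add, eval_pow, eval_X, eval_mul, eval_C]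
    ring
  have hdisc0 : (V'.a₁ ^ 2 + 4 * V'.a₂) ^ 2 ≠ 0 ↔ V'.a₁ ^ 2 + 4 * V'.a₂ ≠ 0 :=
    pow_ne_zero_iff two_ne_zero
  refine ⟨fun hc hsplit => ?_, fun hc hns => ?_, fun hc => ?_⟩
  · -- split node: two rational slopes
    have hQs : Q.Splits :=
      (splits_mul_iff_right (C_ne_zero.mpr hc) (Splits.C _)).mp hsplit
    have hdeg : Q.degree ≠ 0 := by
      have : Q.degree = 2 := by
        rw [hQdef, sub_eq_add_neg, ← map_neg C, ← one_mul (X ^ 2 : k[X]), ← C_1]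
        exact degree_quadratic one_ne_zero
      rw [this]; decide
    obtain ⟨t, ht⟩ := hQs.exists_eval_eq_zero hdeg
    rw [heval] at ht
    have h2 := htwo (hdisc0.mp hc) ⟨t, ht⟩
    omega
  · -- non-split node: no rational slope
    have hno : ¬ ∃ t : k, t ^ 2 + V'.a₁ * t + -V'.a₂ = 0 := by
      rintro ⟨t, ht⟩
      apply hns
      have hfac : Q = (X - C t) * (X - C (-V'.a₁ - t)) := by
        have ha₂ : V'.a₂ = t ^ 2 + V'.a₁ * t := by linear_combination -ht
        rw [hQdef, ha₂]
        simp only [map_add, map_mul, map_pow, map_neg, map_sub]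
        ring
      rw [hfac]
      exact ((Splits.X_sub_C _).mul (Splits.X_sub_C _)).C_mul _
    have h0 := hzero hno
    omega
  · -- cusp: one (double) rational slope
    have h1 := hone (pow_eq_zero_iff two_ne_zero |>.mp hc)
    omega

end Finite

end WeierstrassCurve
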